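/-
Copyright (c) 2026 the pub-hodgecm-mathlib formalisation cell (harness21).  Prover seat hodgecm-mathlib-K2E4-p13 (g2), Track B «K2-LIT» ∕ h413, ‹S› ROAD J brick J1′, rung 3♭:
the compact-side junction WITH THE VALUE of `ψ′` at the centre, for a BOUND Euler–Poincaré datum `(ν₂, m₂, f₂, r)` (twin of ★ rung 3 p855836, K2E4-p08 (g2)).  2026-09-04.
-/
import Literature.NumberTheory.Rogawski1990.LocalTransferCompactSideJunctionValueCM   -- ★ rung 3 p855836 (K2E4-p08): the same junction with J2♯'s OWN witness (brings ★ p842024's kit and its whole closure)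
import HarnessLib

/-!
# The compact-side junction WITH THE VALUE AT THE CENTRE for a BOUND Euler–Poincaré datum — road J brick J1′, rung 3♭

Twin of ★ rung 3 `exists_nhds_finsum_side_eq_stableOrbitalIntegralRel_and_apply_centre_of_compact_dock` (p855836; itself the valued twin of ★ p842024; [Rogawski1990,
Prop. 8.2.1 (a)(d) ⟸ 8.1.3 at the second class; §12.6], [Kottwitz1988, §2]).  ONE difference: rung 3 CONSUMES the Euler–Poincaré letter ★ J2♯
`rankOneEulerPoincareNonsplit_withCentralValue` internally (it returns `∃ r > 0`); HERE the datum is BOUND — Borel structures on `U(Φ₂)_v` and its orbit spaces, a two-sided Haar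
measure `ν₂` with `(pr₁)_* ν_H = ν₂`, a family `m₂` canonical for the regular classes and `ν₂`, a function `f ∈ C_c^∞(U(Φ₂)_v)` with orbital integrals `1` on the regular
elliptic and `0` on the regular split classes (w.r.t. `m₂`), and a real `r₀` with `f(b·1) = −r₀` at every central unit scalar (no sign asked) — EXACTLY ★ J2♯'s inputs and
conclusion fields — and the conclusion is rung 3's `∀ψ`-clause for THIS datum: the compact-side transfer `ψ′ := Δ₁ Ψ(ε_C) · (f ∘ pr₁)` satisfies p842024's identity VERBATIM and
**`ψ′(ε_H) = Δ₁ · (ν′(C′) · D₀ ψ) · (−r₀)`**.  Purpose (K2E4-plan (g2) 2026-09-04T00:23:09Z, road J of ‹S› for crux h413): the (α) «EP-exposed twin export» of ★ J1′ p856014, so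
that the compatible-measure letter ‹J3› can be typed against a NAMED `(f₂, r)`.  PROOF = rung 3's, token for token, with J2♯'s `obtain` replaced by the bound datum (the torus-measure
provider `ht₂` still from ★ `exists_isCanonical_cmDatum_local_two`; the pair lemmas ★ `classOrbitalIntegral_comp_fst_eq_of_compactSpace_of_map_fst` ∕
★ `exists_classOrbitalIntegral_comp_fst_eq_smul_of_haar` fed with `(ν₂, hν₂)`).

* **`exists_nhds_finsum_side_eq_stableOrbitalIntegralRel_and_apply_centre_of_compact_dock_of_EP`**.

HONEST LABEL: a Literature-side helper toward h413 (`stmt-HodgeConjecture-24833`); HC_CM is proved only modulo its printed citations until rung 0 closes; hypothesis-driven on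
`hD′ ∕ hΔ′ ∕ hcnt` exactly like p842024 ∕ p855836, plus the bound EP datum.
-/

set_option autoImplicit false

noncomputable section

open Set Filter Topology MeasureTheory Measure
open scoped Matrix MatrixGroups ENNReal NNReal

namespace Literature.NumberTheory.Rogawski1990

open Literature.NumberTheory.Automorphic Literature.NumberTheory.Automorphic.UnitaryGroup Literature.NumberTheory.GaloisRepresentations
open Literature.MeasureTheory.Group
open _root_.NumberField _root_.IsDedekindDomain

section CompactSideValue

variable (L : Type) [Field L] [NumberField L] [IsCMField L] (H' : Matrix (Fin 3) (Fin 3) L) (v : HeightOneSpectrum (𝓞 ↥(maximalRealSubfield L)))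

variable [iM' : ∀ γ : ((cmDatum L 3 H').Local v), MeasurableSpace (((cmDatum L 3 H').Local v) ⧸ Subgroup.centralizer ({γ} : Set ((cmDatum L 3 H').Local v)))]
  [iH : ∀ a : (((cmDatum L 2 (Matrix.of fun i j : Fin 2 => if i.val + j.val + 1 = 2 then (1 : L) else 0)).Local v) ×
      ((cmDatum L 1 (Matrix.of fun i j : Fin 1 => if i.val + j.val + 1 = 1 then (1 : L) else 0)).Local v)), MeasurableSpace ((((cmDatum L 2 (Matrix.of fun i j : Fin 2 => if i.val + j.val + 1 = 2 then (1 : L) else 0)).Local v) ×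
      ((cmDatum L 1 (Matrix.of fun i j : Fin 1 => if i.val + j.val + 1 = 1 then (1 : L) else 0)).Local v)) ⧸ Subgroup.centralizer ({a} : Set (((cmDatum L 2 (Matrix.of fun i j : Fin 2 => if i.val + j.val + 1 = 2 then (1 : L) else 0)).Local v) ×
      ((cmDatum L 1 (Matrix.of fun i j : Fin 1 => if i.val + j.val + 1 = 1 then (1 : L) else 0)).Local v))))]
  [bH : ∀ a : (((cmDatum L 2 (Matrix.of fun i j : Fin 2 => if i.val + j.val + 1 = 2 then (1 : L) else 0)).Local v) ×
      ((cmDatum L 1 (Matrix.of fun i j : Fin 1 => if i.val + j.val + 1 = 1 then (1 : L) else 0)).Local v)), BorelSpace ((((cmDatum L 2 (Matrix.of fun i j : Fin 2 => if i.val + j.val + 1 = 2 then (1 : L) else 0)).Local v) ×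
      ((cmDatum L 1 (Matrix.of fun i j : Fin 1 => if i.val + j.val + 1 = 1 then (1 : L) else 0)).Local v)) ⧸ Subgroup.centralizer ({a} : Set (((cmDatum L 2 (Matrix.of fun i j : Fin 2 => if i.val + j.val + 1 = 2 then (1 : L) else 0)).Local v) ×
      ((cmDatum L 1 (Matrix.of fun i j : Fin 1 => if i.val + j.val + 1 = 1 then (1 : L) else 0)).Local v))))]
  [MeasurableSpace (((cmDatum L 2 (Matrix.of fun i j : Fin 2 => if i.val + j.val + 1 = 2 then (1 : L) else 0)).Local v) ×
      ((cmDatum L 1 (Matrix.of fun i j : Fin 1 => if i.val + j.val + 1 = 1 then (1 : L) else 0)).Local v))] [BorelSpace (((cmDatum L 2 (Matrix.of fun i j : Fin 2 => if i.val + j.val + 1 = 2 then (1 : L) else 0)).Local v) ×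
      ((cmDatum L 1 (Matrix.of fun i j : Fin 1 => if i.val + j.val + 1 = 1 then (1 : L) else 0)).Local v))]

/-- **THE COMPACT-SIDE JUNCTION WITH THE VALUE AT THE CENTRE, FOR A BOUND EULER–POINCARÉ DATUM** — binders of ★ rung 3
`exists_nhds_finsum_side_eq_stableOrbitalIntegralRel_and_apply_centre_of_compact_dock` (`hD′` reporting `ψ_ε(ε_C) = D₀ ψ`, `Δ₁` explicit, `ε_C` central, `ε_H.1 = a·1`), PLUS the datum
`(ν₂, hν₂, m₂, hm₂, f, hf, hf1, hf0, r₀, hfval)` = ★ J2♯'s inputs and conclusion fields; conclusion = rung 3's `∀ψ`-clause with `ψ′(ε_H) = Δ₁ · (ν′(C′) · D₀ ψ) · (−r₀)`.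
[cite: Rogawski1990, §8.2 Prop. 8.2.1 (a)(d) p. 112; §8.1 Prop. 8.1.3 pp. 110–111; §12.6 p. 174] [cite: LanglandsShelstad1990Descent, §2.4] [cite: Kottwitz1988, §2 Theorem 2] -/
theorem exists_nhds_finsum_side_eq_stableOrbitalIntegralRel_and_apply_centre_of_compact_dock_of_EP
    (hv : Subsingleton (UnitaryGroup.PlacesOver L v)) (μ : HeckeCharacter L)
    (hl : ∀ (v : HeightOneSpectrum (𝓞 ↥(maximalRealSubfield L))) (a : (((cmDatum L 2 (Matrix.of fun i j : Fin 2 => if i.val + j.val + 1 = 2 then (1 : L) else 0)).Local v) ×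
      ((cmDatum L 1 (Matrix.of fun i j : Fin 1 => if i.val + j.val + 1 = 1 then (1 : L) else 0)).Local v))) (b : ((cmDatum L 3 H').Local v)) (x : (((cmDatum L 2 (Matrix.of fun i j : Fin 2 => if i.val + j.val + 1 = 2 then (1 : L) else 0)).Local v) ×
      ((cmDatum L 1 (Matrix.of fun i j : Fin 1 => if i.val + j.val + 1 = 1 then (1 : L) else 0)).Local v))),
      finExplicitDelta L v H' (x * a * x⁻¹) μ b = finExplicitDelta L v H' a μ b)
    (hr : ∀ (v : HeightOneSpectrum (𝓞 ↥(maximalRealSubfield L))) (a : (((cmDatum L 2 (Matrix.of fun i j : Fin 2 => if i.val + j.val + 1 = 2 then (1 : L) else 0)).Local v) ×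
      ((cmDatum L 1 (Matrix.of fun i j : Fin 1 => if i.val + j.val + 1 = 1 then (1 : L) else 0)).Local v))) (b y : ((cmDatum L 3 H').Local v)),
      finExplicitDelta L v H' a μ (y * b * y⁻¹) = finExplicitDelta L v H' a μ b)
    (νH : Measure (((cmDatum L 2 (Matrix.of fun i j : Fin 2 => if i.val + j.val + 1 = 2 then (1 : L) else 0)).Local v) ×
      ((cmDatum L 1 (Matrix.of fun i j : Fin 1 => if i.val + j.val + 1 = 1 then (1 : L) else 0)).Local v))) [νH.IsHaarMeasure] [νH.IsMulRightInvariant]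
    {mH : OrbitalMeasureFamily (((cmDatum L 2 (Matrix.of fun i j : Fin 2 => if i.val + j.val + 1 = 2 then (1 : L) else 0)).Local v) ×
      ((cmDatum L 1 (Matrix.of fun i j : Fin 1 => if i.val + j.val + 1 = 1 then (1 : L) else 0)).Local v))} {mG : OrbitalMeasureFamily ((cmDatum L 3 H').Local v)}
    (hmH : mH.IsCanonical (IsLocalGRegular L v) νH)
    (εH : (((cmDatum L 2 (Matrix.of fun i j : Fin 2 => if i.val + j.val + 1 = 2 then (1 : L) else 0)).Local v) ×
      ((cmDatum L 1 (Matrix.of fun i j : Fin 1 => if i.val + j.val + 1 = 1 then (1 : L) else 0)).Local v)))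
    (a : LocalRing L v) (ha : (εH.1.val.val : Matrix (Fin 2) (Fin 2) (LocalRing L v)) = a • (1 : Matrix (Fin 2) (Fin 2) (LocalRing L v)))
    (Q' : (((cmDatum L 2 (Matrix.of fun i j : Fin 2 => if i.val + j.val + 1 = 2 then (1 : L) else 0)).Local v) ×
      ((cmDatum L 1 (Matrix.of fun i j : Fin 1 => if i.val + j.val + 1 = 1 then (1 : L) else 0)).Local v)) → ((cmDatum L 3 H').Local v) → Prop)
    -- the compact dock at the second class (abstract)
    (C' : Type) [Group C'] [TopologicalSpace C'] [IsTopologicalGroup C'] [CompactSpace C'] [LocallyCompactSpace C'] [SecondCountableTopology C'] [T2Space C']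
    [MeasurableSpace C'] [BorelSpace C']
    [∀ m : C', MeasurableSpace (C' ⧸ Subgroup.centralizer ({m} : Set C'))] [∀ m : C', BorelSpace (C' ⧸ Subgroup.centralizer ({m} : Set C'))]
    (ν' : Measure C') [ν'.IsHaarMeasure] [ν'.IsMulRightInvariant] (P' : C' → Prop) {m' : OrbitalMeasureFamily C'} (hm' : m'.IsCanonical P' ν') (εC : C') (hεC : ∀ k : C', k * εC * k⁻¹ = εC)
    -- the VALUE functional of the descent at the second class (in the application: `ν′(C′)⁻¹ · ∫_{G′_v} ψ(y ε′ y⁻¹) dν_G`)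
    (D₀ : ((cmDatum L 3 H').Local v → ℂ) → ℂ)
    -- (D2ε′)+(sat′): DESCENT at the second class read on `C′`, with compact-side saturation
    (hD' : ∀ ψ : ((cmDatum L 3 H').Local v) → ℂ, IsLocSmooth ψ → ∃ ψε : C' → ℂ, IsLocallyConstant ψε ∧ ψε εC = D₀ ψ ∧ ∀ B' ∈ 𝓝 εC, ∃ V ∈ 𝓝 εH, ∀ γH ∈ V, IsLocalGRegular L v γH →
        ∀ c : ConjClasses ((cmDatum L 3 H').Local v), (∃ x : ((cmDatum L 3 H').Local v), Q' γH (x * Quotient.out c * x⁻¹)) → IsLocalNormPair L H' v γH (Quotient.out c) →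
          ∃ m ∈ B', P' (Quotient.out (ConjClasses.mk m)) ∧ classOrbitalIntegral mG ψ c = classOrbitalIntegral m' ψε (ConjClasses.mk m))
    -- (Δ-θ′): `Δ‴_v` is constant on the matched `Q′`-side classes near `ε_H`
    (Δ₁ : ℂ) (hΔ' : ∃ VΔ ∈ 𝓝 εH, ∀ γH ∈ VΔ, IsLocalGRegular L v γH → ∀ c : ConjClasses ((cmDatum L 3 H').Local v), (∃ x : ((cmDatum L 3 H').Local v), Q' γH (x * Quotient.out c * x⁻¹)) →
        IsLocalNormPair L H' v γH (Quotient.out c) → ((finExplicitCollection L H' μ hl hr) v).Δ γH (Quotient.out c) = Δ₁)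
    -- (CNT): the matched `Q′`-side classes are as many as the stable class of `γ_H` in `H_v` if `Z(γ_H.1)` is compact, none otherwise
    (hcnt : ∃ Vc ∈ 𝓝 εH, ∀ γH ∈ Vc, IsLocalGRegular L v γH →
        {c : ConjClasses ((cmDatum L 3 H').Local v) | (∃ x : ((cmDatum L 3 H').Local v), Q' γH (x * Quotient.out c * x⁻¹)) ∧ IsLocalNormPair L H' v γH (Quotient.out c)}.Finite ∧
        {d : ConjClasses (((cmDatum L 2 (Matrix.of fun i j : Fin 2 => if i.val + j.val + 1 = 2 then (1 : L) else 0)).Local v) ×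
      ((cmDatum L 1 (Matrix.of fun i j : Fin 1 => if i.val + j.val + 1 = 1 then (1 : L) else 0)).Local v)) | IsLocalStablyConjH L v γH (Quotient.out d)}.Finite ∧
        (CompactSpace (Subgroup.centralizer ({γH.1} : Set ((cmDatum L 2 (Matrix.of fun i j : Fin 2 => if i.val + j.val + 1 = 2 then (1 : L) else 0)).Local v))) →
          {c : ConjClasses ((cmDatum L 3 H').Local v) | (∃ x : ((cmDatum L 3 H').Local v), Q' γH (x * Quotient.out c * x⁻¹)) ∧ IsLocalNormPair L H' v γH (Quotient.out c)}.ncard =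
            {d : ConjClasses (((cmDatum L 2 (Matrix.of fun i j : Fin 2 => if i.val + j.val + 1 = 2 then (1 : L) else 0)).Local v) ×
      ((cmDatum L 1 (Matrix.of fun i j : Fin 1 => if i.val + j.val + 1 = 1 then (1 : L) else 0)).Local v)) | IsLocalStablyConjH L v γH (Quotient.out d)}.ncard) ∧
        (¬ CompactSpace (Subgroup.centralizer ({γH.1} : Set ((cmDatum L 2 (Matrix.of fun i j : Fin 2 => if i.val + j.val + 1 = 2 then (1 : L) else 0)).Local v))) →
          ∀ c : ConjClasses ((cmDatum L 3 H').Local v), (∃ x : ((cmDatum L 3 H').Local v), Q' γH (x * Quotient.out c * x⁻¹)) → ¬ IsLocalNormPair L H' v γH (Quotient.out c)))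
    -- the Euler–Poincaré datum on `U(Φ₂)_v` (★ J2♯ `rankOneEulerPoincareNonsplit_withCentralValue`'s inputs and conclusion fields, BOUND)
    [MeasurableSpace ((cmDatum L 2 (Matrix.of fun i j : Fin 2 => if i.val + j.val + 1 = 2 then (1 : L) else 0)).Local v)] [BorelSpace ((cmDatum L 2 (Matrix.of fun i j : Fin 2 => if i.val + j.val + 1 = 2 then (1 : L) else 0)).Local v)]
    [∀ γ : ((cmDatum L 2 (Matrix.of fun i j : Fin 2 => if i.val + j.val + 1 = 2 then (1 : L) else 0)).Local v), MeasurableSpace (((cmDatum L 2 (Matrix.of fun i j : Fin 2 => if i.val + j.val + 1 = 2 then (1 : L) else 0)).Local v) ⧸ Subgroup.centralizer ({γ} : Set ((cmDatum L 2 (Matrix.of fun i j : Fin 2 => if i.val + j.val + 1 = 2 then (1 : L) else 0)).Local v)))]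
    [∀ γ : ((cmDatum L 2 (Matrix.of fun i j : Fin 2 => if i.val + j.val + 1 = 2 then (1 : L) else 0)).Local v), BorelSpace (((cmDatum L 2 (Matrix.of fun i j : Fin 2 => if i.val + j.val + 1 = 2 then (1 : L) else 0)).Local v) ⧸ Subgroup.centralizer ({γ} : Set ((cmDatum L 2 (Matrix.of fun i j : Fin 2 => if i.val + j.val + 1 = 2 then (1 : L) else 0)).Local v)))]
    (ν₂ : Measure ((cmDatum L 2 (Matrix.of fun i j : Fin 2 => if i.val + j.val + 1 = 2 then (1 : L) else 0)).Local v)) [ν₂.IsHaarMeasure] [ν₂.IsMulRightInvariant]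
    (hν₂ : Measure.map (Prod.fst : (((cmDatum L 2 (Matrix.of fun i j : Fin 2 => if i.val + j.val + 1 = 2 then (1 : L) else 0)).Local v) ×
      ((cmDatum L 1 (Matrix.of fun i j : Fin 1 => if i.val + j.val + 1 = 1 then (1 : L) else 0)).Local v)) → ((cmDatum L 2 (Matrix.of fun i j : Fin 2 => if i.val + j.val + 1 = 2 then (1 : L) else 0)).Local v)) νH = ν₂)
    {m₂ : OrbitalMeasureFamily ((cmDatum L 2 (Matrix.of fun i j : Fin 2 => if i.val + j.val + 1 = 2 then (1 : L) else 0)).Local v)} (hm₂ : m₂.IsCanonical (fun γ => IsRegularElt (γ.val : GL (Fin 2) (LocalRing L v))) ν₂)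
    {f : ((cmDatum L 2 (Matrix.of fun i j : Fin 2 => if i.val + j.val + 1 = 2 then (1 : L) else 0)).Local v) → ℂ} (hf : IsLocSmooth f)
    (hf1 : ∀ γ : ((cmDatum L 2 (Matrix.of fun i j : Fin 2 => if i.val + j.val + 1 = 2 then (1 : L) else 0)).Local v), IsRegularElt (γ.val : GL (Fin 2) (LocalRing L v)) → CompactSpace (Subgroup.centralizer ({γ} : Set ((cmDatum L 2 (Matrix.of fun i j : Fin 2 => if i.val + j.val + 1 = 2 then (1 : L) else 0)).Local v))) →
      classOrbitalIntegral m₂ f (ConjClasses.mk γ) = 1)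
    (hf0 : ∀ γ : ((cmDatum L 2 (Matrix.of fun i j : Fin 2 => if i.val + j.val + 1 = 2 then (1 : L) else 0)).Local v), IsRegularElt (γ.val : GL (Fin 2) (LocalRing L v)) → ¬ CompactSpace (Subgroup.centralizer ({γ} : Set ((cmDatum L 2 (Matrix.of fun i j : Fin 2 => if i.val + j.val + 1 = 2 then (1 : L) else 0)).Local v))) →
      classOrbitalIntegral m₂ f (ConjClasses.mk γ) = 0)
    (r₀ : ℝ) (hfval : ∀ (z : ((cmDatum L 2 (Matrix.of fun i j : Fin 2 => if i.val + j.val + 1 = 2 then (1 : L) else 0)).Local v)) (b : LocalRing L v),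
      ((z.val : GL (Fin 2) (LocalRing L v)).val : Matrix (Fin 2) (Fin 2) (LocalRing L v)) = b • (1 : Matrix (Fin 2) (Fin 2) (LocalRing L v)) → f z = -(r₀ : ℂ)) :
    ∀ ψ : ((cmDatum L 3 H').Local v) → ℂ, IsLocSmooth ψ → ∃ V₆ ∈ 𝓝 εH, ∃ ψ' : (((cmDatum L 2 (Matrix.of fun i j : Fin 2 => if i.val + j.val + 1 = 2 then (1 : L) else 0)).Local v) ×
      ((cmDatum L 1 (Matrix.of fun i j : Fin 1 => if i.val + j.val + 1 = 1 then (1 : L) else 0)).Local v)) → ℂ, IsLocSmooth ψ' ∧ (∀ γH ∈ V₆, IsLocalGRegular L v γH →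
      (∑ᶠ c ∈ {c : ConjClasses ((cmDatum L 3 H').Local v) | ∃ x : ((cmDatum L 3 H').Local v), Q' γH (x * Quotient.out c * x⁻¹)},
          ((finExplicitCollection L H' μ hl hr) v).Δ γH (Quotient.out c) * classOrbitalIntegral mG ψ c) =
        stableOrbitalIntegralRel (IsLocalStablyConjH L v) mH ψ' γH) ∧ ψ' εH = Δ₁ * ((((ν'.real Set.univ : ℝ)) : ℂ) * D₀ ψ) * (-(r₀ : ℂ)) := by
  classical
  -- the Borel structure on `H_v` is the product of the (given ∕ Borel) structures of the factors
  letI iU₁ : MeasurableSpace ((cmDatum L 1 (Matrix.of fun i j : Fin 1 => if i.val + j.val + 1 = 1 then (1 : L) else 0)).Local v) := borel _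
  haveI : BorelSpace ((cmDatum L 1 (Matrix.of fun i j : Fin 1 => if i.val + j.val + 1 = 1 then (1 : L) else 0)).Local v) := ⟨rfl⟩
  have hHB : ‹MeasurableSpace (((cmDatum L 2 (Matrix.of fun i j : Fin 2 => if i.val + j.val + 1 = 2 then (1 : L) else 0)).Local v) ×
      ((cmDatum L 1 (Matrix.of fun i j : Fin 1 => if i.val + j.val + 1 = 1 then (1 : L) else 0)).Local v))› = Prod.instMeasurableSpace :=
    (@BorelSpace.measurable_eq (((cmDatum L 2 (Matrix.of fun i j : Fin 2 => if i.val + j.val + 1 = 2 then (1 : L) else 0)).Local v) ×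
      ((cmDatum L 1 (Matrix.of fun i j : Fin 1 => if i.val + j.val + 1 = 1 then (1 : L) else 0)).Local v)) _ ‹MeasurableSpace (((cmDatum L 2 (Matrix.of fun i j : Fin 2 => if i.val + j.val + 1 = 2 then (1 : L) else 0)).Local v) ×
      ((cmDatum L 1 (Matrix.of fun i j : Fin 1 => if i.val + j.val + 1 = 1 then (1 : L) else 0)).Local v))› ‹BorelSpace (((cmDatum L 2 (Matrix.of fun i j : Fin 2 => if i.val + j.val + 1 = 2 then (1 : L) else 0)).Local v) ×
      ((cmDatum L 1 (Matrix.of fun i j : Fin 1 => if i.val + j.val + 1 = 1 then (1 : L) else 0)).Local v))›).trans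
      (@BorelSpace.measurable_eq (((cmDatum L 2 (Matrix.of fun i j : Fin 2 => if i.val + j.val + 1 = 2 then (1 : L) else 0)).Local v) ×
      ((cmDatum L 1 (Matrix.of fun i j : Fin 1 => if i.val + j.val + 1 = 1 then (1 : L) else 0)).Local v)) _ Prod.instMeasurableSpace Prod.borelSpace).symm
  subst hHB
  -- the place `w ∣ v` and compactness of `U(Φ₁)_v`
  obtain ⟨w⟩ : Nonempty (UnitaryGroup.PlacesOver L v) := inferInstance
  have hw : IsCMField.complexConj L • w.1 = w.1 := smul_eq_of_subsingleton_placesOver L hv w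
  haveI : CompactSpace ((cmDatum L 1 (Matrix.of fun i j : Fin 1 => if i.val + j.val + 1 = 1 then (1 : L) else 0)).Local v) := compactSpace_cmDatum_local_one_of_smul_eq L v w hw
  -- the torus-measure provider on `U(Φ₂)_v` (the datum `(ν₂, m₂, f, r₀)` itself is BOUND)
  have ht₂ := (exists_isCanonical_cmDatum_local_two L v ν₂).1
  intro ψ hψ
  -- descent datum for `ψ`, read through the locally constant (C-an) function `Ψ`
  obtain ⟨ψε, hψε, hψεval, hDψ⟩ := hD' ψ hψ
  obtain ⟨Ψ, hΨlc, hΨint, hΨ⟩ := hm'.exists_isLocallyConstant_classOrbitalIntegral_eq ν' hψε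
  have hB' : {m : C' | Ψ m = Ψ εC} ∈ 𝓝 εC := (hΨlc.isOpen_fiber (Ψ εC)).mem_nhds rfl
  obtain ⟨VD, hVD, hdesc⟩ := hDψ _ hB'
  obtain ⟨VΔ, hVΔ, hΔ⟩ := hΔ'
  obtain ⟨Vc, hVc, hcount⟩ := hcnt
  -- the transfer near `ε_H`
  refine ⟨VD ∩ VΔ ∩ Vc, inter_mem (inter_mem hVD hVΔ) hVc, fun h => (Δ₁ * Ψ εC) * f h.1, ?_, ?_, ?_⟩
  · -- smoothness of `ψ′ = C₀ · (f ∘ pr₁)`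
    refine (isLocSmooth_iff _).2 ⟨?_, ?_⟩
    · exact (hf.isLocallyConstant.comp_continuous continuous_fst).comp fun z => (Δ₁ * Ψ εC) * z
    · have hsub : Function.support (fun h : (((cmDatum L 2 (Matrix.of fun i j : Fin 2 => if i.val + j.val + 1 = 2 then (1 : L) else 0)).Local v) ×
      ((cmDatum L 1 (Matrix.of fun i j : Fin 1 => if i.val + j.val + 1 = 1 then (1 : L) else 0)).Local v)) => (Δ₁ * Ψ εC) * f h.1) ⊆ (tsupport f) ×ˢ (Set.univ : Set ((cmDatum L 1 (Matrix.of fun i j : Fin 1 => if i.val + j.val + 1 = 1 then (1 : L) else 0)).Local v)) := by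
        intro h hh
        refine ⟨subset_tsupport _ (Function.mem_support.2 fun h0 => hh ?_), Set.mem_univ _⟩
        show Δ₁ * Ψ εC * f h.1 = 0
        rw [h0, mul_zero]
      exact HasCompactSupport.of_support_subset_isCompact (hf.hasCompactSupport.isCompact.prod isCompact_univ) hsub
  swap
  · -- the VALUE AT THE CENTRE: `ψ′(ε_H) = Δ₁ · Ψ(ε_C) · f(a·1)`, `Ψ(ε_C) = ν′(C′) · ψ_ε(ε_C)` (`ε_C` central), `f(a·1) = −r` (★ J2♯)
    show Δ₁ * Ψ εC * f εH.1 = Δ₁ * ((((ν'.real Set.univ : ℝ)) : ℂ) * D₀ ψ) * (-(r₀ : ℂ))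
    rw [hΨint εC, hfval εH.1 a ha]
    simp_rw [hεC]
    rw [integral_const, Complex.real_smul, hψεval]
  rintro γH ⟨⟨hγD, hγΔ⟩, hγc⟩ hγreg
  obtain ⟨hTfin, hDfin, hcomp, hnon⟩ := hcount γH hγc hγreg
  -- the `Q′`-side: only matched classes contribute, each with the value `Δ₁ · Ψ εC`
  set S : Set (ConjClasses ((cmDatum L 3 H').Local v)) := {c | ∃ x : ((cmDatum L 3 H').Local v), Q' γH (x * Quotient.out c * x⁻¹)} with hS
  set T : Set (ConjClasses ((cmDatum L 3 H').Local v)) := {c | (∃ x : ((cmDatum L 3 H').Local v), Q' γH (x * Quotient.out c * x⁻¹)) ∧ IsLocalNormPair L H' v γH (Quotient.out c)} with hT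
  set F : ConjClasses ((cmDatum L 3 H').Local v) → ℂ := fun c => ((finExplicitCollection L H' μ hl hr) v).Δ γH (Quotient.out c) * classOrbitalIntegral mG ψ c with hF
  have hST : S ∩ Function.support F = T ∩ Function.support F := by
    ext c
    simp only [Set.mem_inter_iff, hS, hT, Set.mem_setOf_eq, Function.mem_support]
    constructor
    · rintro ⟨hx, hne⟩
      refine ⟨⟨hx, ?_⟩, hne⟩
      by_contra hnm
      apply hne
      rw [hF]
      simp only
      rw [finExplicitCollection_Δ L H' μ hl hr v, finExplicitDelta_of_not_isLocalNormPair L v H' γH μ hnm, zero_mul]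
    · rintro ⟨⟨hx, -⟩, hne⟩
      exact ⟨hx, hne⟩
  have hLHS : (∑ᶠ c ∈ S, F c) = (T.ncard : ℂ) * (Δ₁ * Ψ εC) := by
    rw [← finsum_mem_inter_support F S, hST, finsum_mem_inter_support F T, finsum_mem_eq_finite_toFinset_sum _ hTfin,
      Finset.sum_congr rfl (g := fun _ => Δ₁ * Ψ εC), Finset.sum_const, nsmul_eq_mul, Set.ncard_eq_toFinset_card _ hTfin]
    intro c hc
    obtain ⟨hx, hm⟩ := (hTfin.mem_toFinset.1 hc)
    obtain ⟨m, hmB, hPm, hval⟩ := hdesc γH hγD hγreg c hx hm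
    rw [hF]
    simp only
    rw [hΔ γH hγΔ hγreg c hx hm, hval, hΨ m hPm, hmB]
  -- the `H`-side: the stable orbital integral of `ψ′`
  have hRHS : stableOrbitalIntegralRel (IsLocalStablyConjH L v) mH (fun h : (((cmDatum L 2 (Matrix.of fun i j : Fin 2 => if i.val + j.val + 1 = 2 then (1 : L) else 0)).Local v) ×
      ((cmDatum L 1 (Matrix.of fun i j : Fin 1 => if i.val + j.val + 1 = 1 then (1 : L) else 0)).Local v)) => (Δ₁ * Ψ εC) * f h.1) γH =
      ∑ᶠ d ∈ {d : ConjClasses (((cmDatum L 2 (Matrix.of fun i j : Fin 2 => if i.val + j.val + 1 = 2 then (1 : L) else 0)).Local v) ×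
      ((cmDatum L 1 (Matrix.of fun i j : Fin 1 => if i.val + j.val + 1 = 1 then (1 : L) else 0)).Local v)) | IsLocalStablyConjH L v γH (Quotient.out d)}, (Δ₁ * Ψ εC) * classOrbitalIntegral mH (fun h : (((cmDatum L 2 (Matrix.of fun i j : Fin 2 => if i.val + j.val + 1 = 2 then (1 : L) else 0)).Local v) ×
      ((cmDatum L 1 (Matrix.of fun i j : Fin 1 => if i.val + j.val + 1 = 1 then (1 : L) else 0)).Local v)) => f h.1) d := by
    rw [stableOrbitalIntegralRel_def]
    refine finsum_mem_congr rfl fun d _ => ?_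
    have hfun : (fun h : (((cmDatum L 2 (Matrix.of fun i j : Fin 2 => if i.val + j.val + 1 = 2 then (1 : L) else 0)).Local v) ×
      ((cmDatum L 1 (Matrix.of fun i j : Fin 1 => if i.val + j.val + 1 = 1 then (1 : L) else 0)).Local v)) => (Δ₁ * Ψ εC) * f h.1) = (Δ₁ * Ψ εC) • fun h : (((cmDatum L 2 (Matrix.of fun i j : Fin 2 => if i.val + j.val + 1 = 2 then (1 : L) else 0)).Local v) ×
      ((cmDatum L 1 (Matrix.of fun i j : Fin 1 => if i.val + j.val + 1 = 1 then (1 : L) else 0)).Local v)) => f h.1 := by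
      funext h; rfl
    rw [hfun, classOrbitalIntegral_eq, classOrbitalIntegral_eq, orbitalIntegral_smul, smul_eq_mul]
  -- regularity and the pinned-class facts at every class of the stable class
  have hP₁ : ∀ g x : ((cmDatum L 2 (Matrix.of fun i j : Fin 2 => if i.val + j.val + 1 = 2 then (1 : L) else 0)).Local v), IsRegularElt (g.val : GL (Fin 2) (LocalRing L v)) → IsRegularElt ((x * g * x⁻¹ : ((cmDatum L 2 (Matrix.of fun i j : Fin 2 => if i.val + j.val + 1 = 2 then (1 : L) else 0)).Local v)).val : GL (Fin 2) (LocalRing L v)) :=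
    fun g x hg => isRegularElt_fst_conj L v x g hg
  have hclass : ∀ d : ConjClasses (((cmDatum L 2 (Matrix.of fun i j : Fin 2 => if i.val + j.val + 1 = 2 then (1 : L) else 0)).Local v) ×
      ((cmDatum L 1 (Matrix.of fun i j : Fin 1 => if i.val + j.val + 1 = 1 then (1 : L) else 0)).Local v)), IsLocalStablyConjH L v γH (Quotient.out d) →
      IsLocalGRegular L v (Quotient.out (ConjClasses.mk ((Quotient.out d).1, (Quotient.out d).2))) ∧
      IsRegularElt ((Quotient.out (ConjClasses.mk (Quotient.out d).1)).val : GL (Fin 2) (LocalRing L v)) ∧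
      ConjClasses.mk ((Quotient.out d).1, (Quotient.out d).2) = d := by
    intro d hd
    have hdreg : IsLocalGRegular L v (Quotient.out d) := isLocalGRegular_of_isLocalStablyConjH L v hd hγreg
    refine ⟨isLocalGRegular_out_mk hdreg, ?_, Quotient.out_eq d⟩
    obtain ⟨x, hx⟩ := isConj_iff.1 (ConjClasses.mk_eq_mk_iff_isConj.1 (Quotient.out_eq (ConjClasses.mk (Quotient.out d).1)).symm)
    rw [← hx]
    exact isRegularElt_fst_conj L v x _ (isRegularElt_fst_snd_of_isLocalGRegular L v _ hdreg).1
  rw [hLHS, hRHS]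
  by_cases hZ : CompactSpace (Subgroup.centralizer ({γH.1} : Set ((cmDatum L 2 (Matrix.of fun i j : Fin 2 => if i.val + j.val + 1 = 2 then (1 : L) else 0)).Local v)))
  · -- ELLIPTIC: every class of the stable class contributes `Δ₁ Ψ(ε_C) · 1`
    rw [hcomp hZ, finsum_mem_eq_finite_toFinset_sum _ hDfin, Finset.sum_congr rfl (g := fun _ => Δ₁ * Ψ εC), Finset.sum_const, nsmul_eq_mul,
      Set.ncard_eq_toFinset_card _ hDfin]
    intro d hd
    have hst := hDfin.mem_toFinset.1 hd
    obtain ⟨hreg', hreg₁, hmk⟩ := hclass d hst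
    haveI : CompactSpace (Subgroup.centralizer ({(Quotient.out d).1} : Set ((cmDatum L 2 (Matrix.of fun i j : Fin 2 => if i.val + j.val + 1 = 2 then (1 : L) else 0)).Local v))) :=
      (compactSpace_centralizer_fst_iff_of_isLocalStablyConjH L v hγreg hst).1 hZ
    have h1 := hmH.classOrbitalIntegral_comp_fst_eq_of_compactSpace_of_map_fst νH ν₂ hν₂ hm₂
      (Quotient.out d).1 (Quotient.out d).2 hreg' hreg₁ hf.continuous
    rw [hmk] at h1
    rw [h1, hf1 _ (isRegularElt_fst_snd_of_isLocalGRegular L v _ (isLocalGRegular_of_isLocalStablyConjH L v hst hγreg)).1 inferInstance, mul_one]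
  · -- NON-ELLIPTIC: the `Q′`-side is empty and every `H`-side term vanishes
    have hT0 : T = ∅ := by
      refine Set.eq_empty_iff_forall_notMem.2 fun c hc => ?_
      exact hnon hZ c hc.1 hc.2
    rw [hT0, Set.ncard_empty, Nat.cast_zero, zero_mul]
    symm
    refine finsum_mem_of_eqOn_zero fun d hd => ?_
    obtain ⟨hreg', hreg₁, hmk⟩ := hclass d hd
    have hZ' : ¬ CompactSpace (Subgroup.centralizer ({(Quotient.out d).1} : Set ((cmDatum L 2 (Matrix.of fun i j : Fin 2 => if i.val + j.val + 1 = 2 then (1 : L) else 0)).Local v))) :=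
      fun h => hZ ((compactSpace_centralizer_fst_iff_of_isLocalStablyConjH L v hγreg hd).2 h)
    obtain ⟨c₀, -, hc₀⟩ := hmH.exists_classOrbitalIntegral_comp_fst_eq_smul_of_haar νH ν₂ hP₁ hm₂ ht₂
      (Quotient.out d).1 (Quotient.out d).2 hreg' (isRegularElt_fst_snd_of_isLocalGRegular L v _ (isLocalGRegular_of_isLocalStablyConjH L v hd hγreg)).1
    have h1 := hc₀ f
    rw [hmk] at h1
    show Δ₁ * Ψ εC * classOrbitalIntegral mH (fun h => f h.1) d = 0
    rw [h1, hf0 _ (isRegularElt_fst_snd_of_isLocalGRegular L v _ (isLocalGRegular_of_isLocalStablyConjH L v hd hγreg)).1 hZ', mul_zero, mul_zero]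

end CompactSideValue

end Literature.NumberTheory.Rogawski1990

end
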